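import Summits.ABC.IUTFork.Cor312ThetaSlotExactK
import Summits.ABC.IUTFork.Cor312ThetaSideExactK
import Summits.ABC.IUTFork.Cor312ProvKIdeles
import Summits.ABC.IUTFork.Cor312SlotHullJunction
import Summits.ABC.IUTFork.Cor312StatementExactK
import Summits.ABC.IUTFork.LDHGenuinePerImageExplicit
import Summits.ABC.IUTFork.LDHGenuineStepVSum
import Literature.IUT.LogVolume.GenuineLogThetaUnionPerImageResidue
import HarnessLib

/-!
# [IUTchIII] Corollary 3.12 — the JUNCTION of the readings (U) and (P) of `−|log(Θ)|` at the sharp `K`-setting: the two numbers differ by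
# EXACTLY the datum's (Ind1) slot residue (± the rounding sum), COINCIDE at slot-constant data, and `SlotStatement ⟹ Statement` always

PROOF-ONLY file (D-0012; no definitions, no `Prop` facts, nothing re-typed) of the abc-iut cell (R2 S-chain team, seat abc-iut-s2-p2 gen 3,
row «U-P-JUNCTION-K», C-lead GO 2026-08-26T18:46:40Z). TAKES NO SIDE on [IUTchIII] Cor. 3.12, on the reading (U)/(P) of `−|log(Θ)|`, or on
any author.

S. Mochizuki, *Inter-universal Teichmüller theory III* [Mochizuki2012] (kurims manuscript): Cor. 3.12 p. 173 l. 43 – p. 174 l. 18 («the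
holomorphic hull of the union of the possible images of a Θ-pilot object … subject to the indeterminacies (Ind1), (Ind2), (Ind3)» — READING (U):
the cell's frozen `Cor312.Setting.thetaHull` / `negLogTheta` / `Statement`, abc-iut-c312-7); proof Step (x) p. 181 (the log-volume computed for
each possible image) and T. Dupuy, A. Hilado [DupuyHilado2025] §4.9, §4.11–4.12 (the (Ind2)-orbit slot by slot) — READING (P): abc-iut-C-cert-2's
`Cor312SlotHull` (p458847, abc-iut-c312-1's shape; `thetaSlotHull ⊆ thetaHull`, `negLogThetaSlot`, `SlotStatement`, and the REGION-level junction
`licence_of_slotLicence`). *IUT IV* Thm. 1.10 Step (v) p. 27–28 (the per-collection computation whose (Ind1)-symmetrisation is exact only at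
slot-constant collections: abc-iut-c312-d1 STEPV-IND1-NOTE, referee countersign ref-b B7).

PART (i) — `Cor312SlotHullJunction` (abc-iut-s2-p2), generic over any `Cor312.Setting` with monotone log-volume ([IUTchIII] Prop. 3.9 (ii);
abc-iut-c312-6's `Cor312Vol.LogvolMono`): `negLogThetaSlot_le_negLogTheta` (`−|log(Θ)|_(P) ≤ −|log(Θ)|_(U)`), `statement_of_slotStatement`
(`SlotStatement ⟹ Statement` under `ThetaFinite`), `slotStatement_iff_statement_of_negLogThetaSlot_eq` / `…_of_forall_eq`.
THIS FILE — PART (ii), at abc-iut-c312-7's sharp `K`-setting `settingPrVolSharp (pilotDataOfK D K) … tq t` for EVERY realising Θ-idele `t`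
(and ANY `q`-ideles unless said), everything composed BY NAME from the two EXACT readouts — (U) abc-iut-s2-p7
`negLogTheta_settingPrVolSharp_pilotDataOfK_eq_negLogThetaNonarch` (p453133) and (P) abc-iut-s2-p7
`negLogThetaSlot_settingPrVolSharp_pilotDataOfK_eq_negLogThetaPerImageNonarch` (p462135) — and abc-iut-s2-p2's input-level identity
`ThetaVolumeInput.negLogThetaNonarch_perImage_two_sided_of_slotConstantOn` (p439062/p440845):
* §4 `statement_of_slotStatement_settingPrVolSharp_pilotDataOfK` — `SlotStatement ⟹ Statement` with NO side condition (monotonicity and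
  `ThetaFinite` are theorems there, abc-iut-c312-7 `bridgeHyps_settingPrVolSharp_of_ideles`); `negLogThetaSlot_le_negLogTheta_settingPrVolSharp_pilotDataOfK`;
  **`negLogTheta_two_sided_negLogThetaSlot_settingPrVolSharp_pilotDataOfK`** — for any set `C` of slot-constant support primes,
  `−|log(Θ)|_(P) + ↑(SR(I) − Σ_{p∈T(I)∖C} log p) ≤ −|log(Θ)|_(U) ≤ −|log(Θ)|_(P) + ↑(SR(I) + Σ_{p∈T(I)∖C} log p)`, `SR(I) = P_Θ.slotResidue T(I)` the
  (Ind1) slot residue of the pilot data (abc-iut-S8 / abc-iut-s2-p2: `((l+1)/24)`× the log-`q` share at the MIXED primes, two-sided);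
  **`negLogThetaSlot_eq_negLogTheta_settingPrVolSharp_pilotDataOfK_of_slotConstant`**, **`slotStatement_iff_statement_…_of_slotConstant`**,
  `…_of_finrank_eq_one` — at SLOT-CONSTANT inputs (one slot value over each support prime: every `d_mod = 1` datum, every input with one place
  of `F_mod` over each `p ∈ T(I)`) the two numbers and the two typed conclusions of Cor. 3.12 COINCIDE;
* §5 **`slotStatement_settingPrVolSharp_pilotDataOfK_iff_cor312PerImageNonarchOf`** — for realising `q`-ideles too: the reading-(P) conclusion IS
  Dupuy–Hilado's (1.1) PER IMAGE (nonarchimedean form) for the genuine input — the (P) twin of abc-iut-s2-p7's `…_iff_cor312NonarchOf` (p453952);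
`GenuineK.cor312PerImageNonarch_add_slotResidue_of_statement` — conversely the (U) conclusion gives (1.1) per image WEAKENED BY EXACTLY
  `SR(I) + Σ_{p∈T(I)} log p`;
* §6 `slotStatement_settingPrVolSharp_pilotDataOfK_chosen_readout` — at a genuine Θ-volume DATUM for the CHOSEN realising ideles (the binder
  shape of the `K`-line certificates): «γ's `hstPBad` body ↔ `T.I.Cor312PerImageNonarchOf`» and «γ's `hstPBad` body ⟹ the (U) statement lines'
  `hstBad` body» (abc-iut-C-cert-2 `abc_of_slotStatement_genuineK_szpiroBad` p458998 vs abc-iut-s2-p10 p455513), LITERALLY.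

USE (branch C, LETTER C «honest cost of γ»): the reading-(P) binders are print's reading-(U) binders EXACTLY at slot-constant data and STRONGER
by at most the datum's slot residue elsewhere — the quantity whose (U)-line cone binder is refuted as typed (`Conditional.not_hreg_v4`, p453135).
HONEST SCOPE: identities/inequalities between OUR two typings; nothing asserts either statement at any datum; typed ≠ proved.
[cite: Mochizuki2012, IUTchIII Cor. 3.12 p. 173–174, proof Step (x) p. 181; Prop. 3.9 (ii) p. 116; Rmk. 3.9.5 (ii) p. 127; Thm. 3.11 (i) p. 154]
[cite: Mochizuki2012, IUTchIV Thm. 1.10 Step (v) p. 27–28] [cite: DupuyHilado2025, §4.7, §4.9, §4.11–4.12] [claim: Mochizuki2012, status: disputed]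
for every quoted construction.
-/

noncomputable section

/-! ## §4. At the sharp `K`-setting: the two numbers differ by EXACTLY the (Ind1) slot residue; coincidence at slot-constant data -/

namespace Summit.ABC.IUTFork.Thm311.Real

open Cor312 Cor312Vol Cor312Prov Literature.IUT.LogThetaLattice Literature.IUT.LogVolume Literature.IUT.HodgeTheaters
  Literature.NumberTheory.NumberFields

variable {F K Fbar : Type} [Field F] [NumberField F] [Field K] [NumberField K] [Algebra F K] [Field Fbar]
  [Algebra F Fbar] [Algebra K Fbar] {E : WeierstrassCurve F} [E.IsElliptic] {l : ℕ} {Pb : BadPlacePredicates K}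
  (D : InitialThetaData F K Fbar E l Pb)
  (M : Type) [Field M] [NumberField M]
  (archPk : ∀ (j : (thetaIndex (pilotDataOfK D K)).Label) (vQ : (thetaIndex (pilotDataOfK D K)).VQ),
    Set ((logShellsDH (pilotDataOfK D K) (analyticLogv K)).Packet j vQ))
  (archSub : ∀ (j : (thetaIndex (pilotDataOfK D K)).Label) (v : (thetaIndex (pilotDataOfK D K)).V),
    Set ((logShellsDH (pilotDataOfK D K) (analyticLogv K)).Packet j ((thetaIndex (pilotDataOfK D K)).over v)))
  (Ψ : ℤ → ∀ v : (thetaIndex (pilotDataOfK D K)).V, v ∈ (thetaIndex (pilotDataOfK D K)).Vbad →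
    Set ((logShellsDH (pilotDataOfK D K) (analyticLogv K)).StarPacket v))
  (act : ℤ → ∀ v : (thetaIndex (pilotDataOfK D K)).V, v ∈ (thetaIndex (pilotDataOfK D K)).Vbad →
    (logShellsDH (pilotDataOfK D K) (analyticLogv K)).StarPacket v →
      Module.End ℚ ((logShellsDH (pilotDataOfK D K) (analyticLogv K)).StarPacket v))
  (Mmod : ℤ → ∀ j : (thetaIndex (pilotDataOfK D K)).LabelStar,
    Set ((logShellsDH (pilotDataOfK D K) (analyticLogv K)).GlobalPacket j.1))
  (region : ℤ → ∀ j : (thetaIndex (pilotDataOfK D K)).LabelStar, FinDivisor M → ∀ vQ : (thetaIndex (pilotDataOfK D K)).VQ,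
    Set ((logShellsDH (pilotDataOfK D K) (analyticLogv K)).Packet j.1 vQ))
  (n : ℤ) {HT : Type} {LogLink : HT → HT → Type} {IsFull : ∀ {s t : HT}, LogLink s t → Prop}
  (lat : LGPGaussianLogThetaLattice LogLink IsFull)
  {Frd : Type} {IsoF : Frd → Frd → Type} {Ob : Frd → Type} {realify : Frd → Frd} {Strip : Type}
  {IsoS : Strip → Strip → Type}
  {Mv : ∀ v : (thetaIndex (pilotDataOfK D K)).V, v ∈ (thetaIndex (pilotDataOfK D K)).Vbad → Type} [∀ v h, Monoid (Mv v h)]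
  (sig : GlobalLGPFrobenioidSignature (thetaIndex (pilotDataOfK D K)).lstar (thetaIndex (pilotDataOfK D K)).V
    (· ∈ (thetaIndex (pilotDataOfK D K)).Vbad) Frd IsoF Ob realify Strip IsoS Mv)
  (split : SplittingMonoids Mv) {ObΔ : Type}
  {N : ∀ v : (thetaIndex (pilotDataOfK D K)).V, v ∈ (thetaIndex (pilotDataOfK D K)).Vbad → Type} [∀ v h, Monoid (N v h)]
  (qData : QPilotData ObΔ N)
  (tq : ∀ (pp : Nat.Primes) (x : (thetaIndex (pilotDataOfK D K)).Fibre (.inr pp)),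
    haveI : Fact (pp : ℕ).Prime := ⟨pp.2⟩; kOf (pilotDataOfK D K) pp.1 x)
  (t : ∀ (pp : Nat.Primes) (_ : Fin (pilotDataOfK D K).lstar) (x : (thetaIndex (pilotDataOfK D K)).Fibre (.inr pp)),
    haveI : Fact (pp : ℕ).Prime := ⟨pp.2⟩; kOf (pilotDataOfK D K) pp.1 x)
  (htq0 : ∀ pp x, tq pp x ≠ 0)
  (htq1 : ∀ (pp : Nat.Primes) (x : (thetaIndex (pilotDataOfK D K)).Fibre (.inr pp)),
    haveI : Fact (pp : ℕ).Prime := ⟨pp.2⟩; placeOf (pilotDataOfK D K) pp.1 x ∉ (pilotDataOfK D K).S → ‖tq pp x‖ = 1)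

/-- **`SlotStatement ⟹ Statement` at the sharp `K`-setting, NO side condition** (for every Θ-idele `t` realising `P_Θ` and any
`q`-ideles): monotone log-volume and `ThetaFinite` are THEOREMS there (abc-iut-c312-7 `bridgeHyps_settingPrVolSharp_of_ideles`; a realising
Θ-idele is a unit off `S`, abc-iut-s2-p7 `norm_eq_one_of_realising_of_not_mem`), so §2's `statement_of_slotStatement` applies outright.
[cite: Mochizuki2012, IUTchIII Cor. 3.12 p. 174 l. 16–18; Prop. 3.9 (ii) p. 116] [claim: Mochizuki2012, status: disputed] -/
theorem statement_of_slotStatement_settingPrVolSharp_pilotDataOfK (ht0 : ∀ pp i x, t pp i x ≠ 0)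
    (hT : ∀ (pp : Nat.Primes) (i : Fin (pilotDataOfK D K).lstar) (x : (thetaIndex (pilotDataOfK D K)).Fibre (.inr pp)),
      haveI : Fact (pp : ℕ).Prime := ⟨pp.2⟩
      Real.log ‖t pp i x‖ = -((pilotDataOfK D K).thetaPilot i (placeOf (pilotDataOfK D K) pp.1 x)) *
        logNorm K (placeOf (pilotDataOfK D K) pp.1 x) / localDegree K (placeOf (pilotDataOfK D K) pp.1 x))
    (h : (settingPrVolSharp (pilotDataOfK D K) (logvAnalytic_analyticLogv (F := K)) M archPk archSub Ψ act Mmod region n lat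
        sig split qData tq t htq0 htq1).SlotStatement) :
    (settingPrVolSharp (pilotDataOfK D K) (logvAnalytic_analyticLogv (F := K)) M archPk archSub Ψ act Mmod region n lat
        sig split qData tq t htq0 htq1).Statement := by
  have H := bridgeHyps_settingPrVolSharp_of_ideles (pilotDataOfK D K) (logvAnalytic_analyticLogv (F := K)) M archPk archSub Ψ act Mmod
    region n lat sig split qData t tq ht0 (fun pp i x hx => norm_eq_one_of_realising_of_not_mem D t ht0 hT pp i x hx) htq0 htq1
  exact Cor312.Setting.statement_of_slotStatement _ H.mono H.finite h

/-- `ThetaSlotFinite` at the sharp `K`-setting («`−|log(Θ)|_(P)` is finite»: it is the real number `I.negLogThetaPerImageNonarch`,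
abc-iut-s2-p7 p462135). [cite: Mochizuki2012, IUTchIII Cor. 3.12 proof Step (x) p. 181] [claim: Mochizuki2012, status: disputed] -/
theorem thetaSlotFinite_settingPrVolSharp_pilotDataOfK (ht0 : ∀ pp i x, t pp i x ≠ 0)
    (hT : ∀ (pp : Nat.Primes) (i : Fin (pilotDataOfK D K).lstar) (x : (thetaIndex (pilotDataOfK D K)).Fibre (.inr pp)),
      haveI : Fact (pp : ℕ).Prime := ⟨pp.2⟩
      Real.log ‖t pp i x‖ = -((pilotDataOfK D K).thetaPilot i (placeOf (pilotDataOfK D K) pp.1 x)) *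
        logNorm K (placeOf (pilotDataOfK D K) pp.1 x) / localDegree K (placeOf (pilotDataOfK D K) pp.1 x))
    {I : ThetaVolumeInput (fieldOfModuli E) K} (hI : ThetaData.IsVolumeInputOf D I) :
    (settingPrVolSharp (pilotDataOfK D K) (logvAnalytic_analyticLogv (F := K)) M archPk archSub Ψ act Mmod region n lat
        sig split qData tq t htq0 htq1).ThetaSlotFinite := by
  refine Cor312.Setting.thetaSlotFinite_of_negLogThetaSlot_ne_top _ ?_
  rw [negLogThetaSlot_settingPrVolSharp_pilotDataOfK_eq_negLogThetaPerImageNonarch_of_isVolumeInputOf D M archPk archSub Ψ act Mmod region n lat sig split qData tq t htq0 htq1 ht0 hT hI]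
  exact WithTop.coe_ne_top

/-- **`−|log(Θ)|_(P) ≤ −|log(Θ)|_(U)` at the sharp `K`-setting, NO side condition** (§2 with the setting's monotone log-volume).
[cite: Mochizuki2012, IUTchIII Cor. 3.12 p. 173–174, proof Step (x) p. 181; Prop. 3.9 (ii) p. 116] [cite: DupuyHilado2025, §4.12]
[claim: Mochizuki2012, status: disputed] -/
theorem negLogThetaSlot_le_negLogTheta_settingPrVolSharp_pilotDataOfK (ht0 : ∀ pp i x, t pp i x ≠ 0)
    (hT : ∀ (pp : Nat.Primes) (i : Fin (pilotDataOfK D K).lstar) (x : (thetaIndex (pilotDataOfK D K)).Fibre (.inr pp)),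
      haveI : Fact (pp : ℕ).Prime := ⟨pp.2⟩
      Real.log ‖t pp i x‖ = -((pilotDataOfK D K).thetaPilot i (placeOf (pilotDataOfK D K) pp.1 x)) *
        logNorm K (placeOf (pilotDataOfK D K) pp.1 x) / localDegree K (placeOf (pilotDataOfK D K) pp.1 x))
    {I : ThetaVolumeInput (fieldOfModuli E) K} (hI : ThetaData.IsVolumeInputOf D I) :
    (settingPrVolSharp (pilotDataOfK D K) (logvAnalytic_analyticLogv (F := K)) M archPk archSub Ψ act Mmod region n lat
        sig split qData tq t htq0 htq1).negLogThetaSlot ≤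
      (settingPrVolSharp (pilotDataOfK D K) (logvAnalytic_analyticLogv (F := K)) M archPk archSub Ψ act Mmod region n lat
        sig split qData tq t htq0 htq1).negLogTheta := by
  have H := bridgeHyps_settingPrVolSharp_of_ideles (pilotDataOfK D K) (logvAnalytic_analyticLogv (F := K)) M archPk archSub Ψ act Mmod
    region n lat sig split qData t tq ht0 (fun pp i x hx => norm_eq_one_of_realising_of_not_mem D t ht0 hT pp i x hx) htq0 htq1
  exact Cor312.Setting.negLogThetaSlot_le_negLogTheta _ H.mono
    (thetaSlotFinite_settingPrVolSharp_pilotDataOfK D M archPk archSub Ψ act Mmod region n lat sig split qData tq t htq0 htq1 ht0 hT hI)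

/-- **THE JUNCTION, two-sided**: at the sharp `K`-setting, for EVERY realising Θ-idele, any `q`-ideles and any set `C ⊆ T(I)` of support
primes at which the genuine input `I` is SLOT-CONSTANT (one slot value `θ_i` over all places of `F_mod` above `p`),
`−|log(Θ)|_(P) + ↑(SR(I) − Σ_{p∈T(I)∖C} log p) ≤ −|log(Θ)|_(U) ≤ −|log(Θ)|_(P) + ↑(SR(I) + Σ_{p∈T(I)∖C} log p)`, where
`SR(I) = P_Θ.slotResidue T(I)` is the (Ind1) SLOT RESIDUE of the pilot data (abc-iut-S8; = `((l+1)/24)`× the log-`q` share at the MIXED primes,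
two-sided, abc-iut-s2-p2 `PilotSlotResidueMixedShare`). The two exact readouts (U) p453133 / (P) p462135 of abc-iut-s2-p7 composed with
abc-iut-s2-p2's input-level identity `negLogThetaNonarch_perImage_two_sided_of_slotConstantOn` (p440845). With `C = ∅` the rounding sum is
`Σ_{p∈T(I)} log p ≤ 2·d_mod·(log-diff + log-cond) + log(30·l)` at a datum (abc-iut-S3). [cite: Mochizuki2012, IUTchIII Cor. 3.12 p. 173–174, proof
Step (x) p. 181; Thm. 3.11 (i) (Ind1) p. 154] [cite: Mochizuki2012, IUTchIV Thm. 1.10 Step (v) p. 27–28] [cite: DupuyHilado2025, §4.7, §4.11–4.12]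
[claim: Mochizuki2012, status: disputed] -/
theorem negLogTheta_two_sided_negLogThetaSlot_settingPrVolSharp_pilotDataOfK (ht0 : ∀ pp i x, t pp i x ≠ 0)
    (hT : ∀ (pp : Nat.Primes) (i : Fin (pilotDataOfK D K).lstar) (x : (thetaIndex (pilotDataOfK D K)).Fibre (.inr pp)),
      haveI : Fact (pp : ℕ).Prime := ⟨pp.2⟩
      Real.log ‖t pp i x‖ = -((pilotDataOfK D K).thetaPilot i (placeOf (pilotDataOfK D K) pp.1 x)) *
        logNorm K (placeOf (pilotDataOfK D K) pp.1 x) / localDegree K (placeOf (pilotDataOfK D K) pp.1 x))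
    {I : ThetaVolumeInput (fieldOfModuli E) K} (hI : ThetaData.IsVolumeInputOf D I) (C : Finset ℕ) (hC : C ⊆ I.supportPrimes)
    (hconst : ∀ p ∈ C, ∀ (i : Fin I.X.lstar) (v w : placesOver (fieldOfModuli E) p), I.X.slotValue i v.1 = I.X.slotValue i w.1) :
    (settingPrVolSharp (pilotDataOfK D K) (logvAnalytic_analyticLogv (F := K)) M archPk archSub Ψ act Mmod region n lat
        sig split qData tq t htq0 htq1).negLogThetaSlot +
        (((I.X.slotResidue I.supportPrimes - ∑ p ∈ I.supportPrimes \ C, Real.log p : ℝ)) : WithTop ℝ) ≤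
      (settingPrVolSharp (pilotDataOfK D K) (logvAnalytic_analyticLogv (F := K)) M archPk archSub Ψ act Mmod region n lat
        sig split qData tq t htq0 htq1).negLogTheta ∧
    (settingPrVolSharp (pilotDataOfK D K) (logvAnalytic_analyticLogv (F := K)) M archPk archSub Ψ act Mmod region n lat
        sig split qData tq t htq0 htq1).negLogTheta ≤
      (settingPrVolSharp (pilotDataOfK D K) (logvAnalytic_analyticLogv (F := K)) M archPk archSub Ψ act Mmod region n lat
        sig split qData tq t htq0 htq1).negLogThetaSlot +
        (((I.X.slotResidue I.supportPrimes + ∑ p ∈ I.supportPrimes \ C, Real.log p : ℝ)) : WithTop ℝ) := by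
  rw [negLogTheta_settingPrVolSharp_pilotDataOfK_eq_negLogThetaNonarch_of_isVolumeInputOf D M archPk archSub Ψ act Mmod region n lat sig split qData tq t htq0 htq1 ht0 hT hI,
    negLogThetaSlot_settingPrVolSharp_pilotDataOfK_eq_negLogThetaPerImageNonarch_of_isVolumeInputOf D M archPk archSub Ψ act Mmod region n lat sig split qData tq t htq0 htq1 ht0 hT hI,
    ← WithTop.coe_add, ← WithTop.coe_add, WithTop.coe_le_coe, WithTop.coe_le_coe]
  have h := I.negLogThetaNonarch_perImage_two_sided_of_slotConstantOn C hC hconst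
  constructor <;> linarith [h.1, h.2]

/-- **… with no slot-constancy information** (`C = ∅`): `|−|log(Θ)|_(U) − −|log(Θ)|_(P) − SR(I)| ≤ Σ_{p∈T(I)} log p` at the sharp `K`-setting.
[cite: Mochizuki2012, IUTchIII Cor. 3.12 p. 173–174, proof Step (x) p. 181] [cite: Mochizuki2012, IUTchIV Thm. 1.10 Step (v) p. 27–28]
[claim: Mochizuki2012, status: disputed] -/
theorem negLogTheta_two_sided_negLogThetaSlot_settingPrVolSharp_pilotDataOfK' (ht0 : ∀ pp i x, t pp i x ≠ 0)
    (hT : ∀ (pp : Nat.Primes) (i : Fin (pilotDataOfK D K).lstar) (x : (thetaIndex (pilotDataOfK D K)).Fibre (.inr pp)),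
      haveI : Fact (pp : ℕ).Prime := ⟨pp.2⟩
      Real.log ‖t pp i x‖ = -((pilotDataOfK D K).thetaPilot i (placeOf (pilotDataOfK D K) pp.1 x)) *
        logNorm K (placeOf (pilotDataOfK D K) pp.1 x) / localDegree K (placeOf (pilotDataOfK D K) pp.1 x))
    {I : ThetaVolumeInput (fieldOfModuli E) K} (hI : ThetaData.IsVolumeInputOf D I) :
    (settingPrVolSharp (pilotDataOfK D K) (logvAnalytic_analyticLogv (F := K)) M archPk archSub Ψ act Mmod region n lat
        sig split qData tq t htq0 htq1).negLogThetaSlot +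
        (((I.X.slotResidue I.supportPrimes - ∑ p ∈ I.supportPrimes, Real.log p : ℝ)) : WithTop ℝ) ≤
      (settingPrVolSharp (pilotDataOfK D K) (logvAnalytic_analyticLogv (F := K)) M archPk archSub Ψ act Mmod region n lat
        sig split qData tq t htq0 htq1).negLogTheta ∧
    (settingPrVolSharp (pilotDataOfK D K) (logvAnalytic_analyticLogv (F := K)) M archPk archSub Ψ act Mmod region n lat
        sig split qData tq t htq0 htq1).negLogTheta ≤
      (settingPrVolSharp (pilotDataOfK D K) (logvAnalytic_analyticLogv (F := K)) M archPk archSub Ψ act Mmod region n lat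
        sig split qData tq t htq0 htq1).negLogThetaSlot +
        (((I.X.slotResidue I.supportPrimes + ∑ p ∈ I.supportPrimes, Real.log p : ℝ)) : WithTop ℝ) := by
  have h := negLogTheta_two_sided_negLogThetaSlot_settingPrVolSharp_pilotDataOfK D M archPk archSub Ψ act Mmod region n lat sig split qData tq t htq0 htq1 ht0 hT hI ∅
    (Finset.empty_subset _) (fun p hp => absurd hp (Finset.notMem_empty p))
  rwa [Finset.sdiff_empty] at h

/-- **COINCIDENCE AT SLOT-CONSTANT DATA**: if the genuine input is slot-constant at EVERY support prime (one slot value over each `p ∈ T(I)`: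
every `d_mod = 1` datum; every input whose `F_mod` has one place over each support prime), then at the sharp `K`-setting
`−|log(Θ)|_(P) = −|log(Θ)|_(U)` for every realising Θ-idele and any `q`-ideles — reading (P) costs NOTHING more than print's reading (U) there
([IUTchIV] Step (v)'s symmetrisation is exact; abc-iut-s2-p2 `negLogThetaNonarch_eq_perImage_of_slotConstant`, abc-iut-c312-d1
`LDHGenuinePerImageSlotConstant` in the `log(q_v)` currency). [cite: Mochizuki2012, IUTchIII Cor. 3.12 p. 173–174, proof Step (x) p. 181]
[cite: Mochizuki2012, IUTchIV Thm. 1.10 Step (v) p. 28] [cite: DupuyHilado2025, §4.7, §4.12] [claim: Mochizuki2012, status: disputed] -/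
theorem negLogThetaSlot_eq_negLogTheta_settingPrVolSharp_pilotDataOfK_of_slotConstant (ht0 : ∀ pp i x, t pp i x ≠ 0)
    (hT : ∀ (pp : Nat.Primes) (i : Fin (pilotDataOfK D K).lstar) (x : (thetaIndex (pilotDataOfK D K)).Fibre (.inr pp)),
      haveI : Fact (pp : ℕ).Prime := ⟨pp.2⟩
      Real.log ‖t pp i x‖ = -((pilotDataOfK D K).thetaPilot i (placeOf (pilotDataOfK D K) pp.1 x)) *
        logNorm K (placeOf (pilotDataOfK D K) pp.1 x) / localDegree K (placeOf (pilotDataOfK D K) pp.1 x))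
    {I : ThetaVolumeInput (fieldOfModuli E) K} (hI : ThetaData.IsVolumeInputOf D I)
    (hconst : ∀ p ∈ I.supportPrimes, ∀ (i : Fin I.X.lstar) (v w : placesOver (fieldOfModuli E) p),
      I.X.slotValue i v.1 = I.X.slotValue i w.1) :
    (settingPrVolSharp (pilotDataOfK D K) (logvAnalytic_analyticLogv (F := K)) M archPk archSub Ψ act Mmod region n lat
        sig split qData tq t htq0 htq1).negLogThetaSlot =
      (settingPrVolSharp (pilotDataOfK D K) (logvAnalytic_analyticLogv (F := K)) M archPk archSub Ψ act Mmod region n lat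
        sig split qData tq t htq0 htq1).negLogTheta := by
  rw [negLogTheta_settingPrVolSharp_pilotDataOfK_eq_negLogThetaNonarch_of_isVolumeInputOf D M archPk archSub Ψ act Mmod region n lat sig split qData tq t htq0 htq1 ht0 hT hI,
    negLogThetaSlot_settingPrVolSharp_pilotDataOfK_eq_negLogThetaPerImageNonarch_of_isVolumeInputOf D M archPk archSub Ψ act Mmod region n lat sig split qData tq t htq0 htq1 ht0 hT hI,
    I.negLogThetaNonarch_eq_perImage_of_slotConstant hconst]

/-- **`SlotStatement ↔ Statement` AT SLOT-CONSTANT DATA** (sharp `K`-setting, every realising Θ-idele, any `q`-ideles): the γ line's reading-(P)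
conclusion of [IUTchIII] Cor. 3.12 and print's reading-(U) conclusion are THE SAME CLAIM there. [cite: Mochizuki2012, IUTchIII Cor. 3.12 p. 174
l. 16–18, proof Step (x) p. 181] [claim: Mochizuki2012, status: disputed] -/
theorem slotStatement_iff_statement_settingPrVolSharp_pilotDataOfK_of_slotConstant (ht0 : ∀ pp i x, t pp i x ≠ 0)
    (hT : ∀ (pp : Nat.Primes) (i : Fin (pilotDataOfK D K).lstar) (x : (thetaIndex (pilotDataOfK D K)).Fibre (.inr pp)),
      haveI : Fact (pp : ℕ).Prime := ⟨pp.2⟩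
      Real.log ‖t pp i x‖ = -((pilotDataOfK D K).thetaPilot i (placeOf (pilotDataOfK D K) pp.1 x)) *
        logNorm K (placeOf (pilotDataOfK D K) pp.1 x) / localDegree K (placeOf (pilotDataOfK D K) pp.1 x))
    {I : ThetaVolumeInput (fieldOfModuli E) K} (hI : ThetaData.IsVolumeInputOf D I)
    (hconst : ∀ p ∈ I.supportPrimes, ∀ (i : Fin I.X.lstar) (v w : placesOver (fieldOfModuli E) p),
      I.X.slotValue i v.1 = I.X.slotValue i w.1) :
    (settingPrVolSharp (pilotDataOfK D K) (logvAnalytic_analyticLogv (F := K)) M archPk archSub Ψ act Mmod region n lat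
        sig split qData tq t htq0 htq1).SlotStatement ↔
      (settingPrVolSharp (pilotDataOfK D K) (logvAnalytic_analyticLogv (F := K)) M archPk archSub Ψ act Mmod region n lat
        sig split qData tq t htq0 htq1).Statement :=
  Cor312.Setting.slotStatement_iff_statement_of_negLogThetaSlot_eq _
    (negLogThetaSlot_eq_negLogTheta_settingPrVolSharp_pilotDataOfK_of_slotConstant D M archPk archSub Ψ act Mmod region n lat sig split qData tq t htq0 htq1 ht0 hT hI hconst)

/-- **… in particular for `F_mod` of degree one** (`d_mod = 1`: one place of `F_mod` over each prime, abc-iut-c312-d1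
`DHData.slotConstant_of_finrank_eq_one`): the two typed conclusions of Cor. 3.12 coincide at the sharp `K`-setting — RISK 7 / the (Ind1)
slot residue is void there. [cite: Mochizuki2012, IUTchIII Cor. 3.12 p. 174 l. 16–18] [claim: Mochizuki2012, status: disputed] -/
theorem slotStatement_iff_statement_settingPrVolSharp_pilotDataOfK_of_finrank_eq_one (ht0 : ∀ pp i x, t pp i x ≠ 0)
    (hT : ∀ (pp : Nat.Primes) (i : Fin (pilotDataOfK D K).lstar) (x : (thetaIndex (pilotDataOfK D K)).Fibre (.inr pp)),
      haveI : Fact (pp : ℕ).Prime := ⟨pp.2⟩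
      Real.log ‖t pp i x‖ = -((pilotDataOfK D K).thetaPilot i (placeOf (pilotDataOfK D K) pp.1 x)) *
        logNorm K (placeOf (pilotDataOfK D K) pp.1 x) / localDegree K (placeOf (pilotDataOfK D K) pp.1 x))
    {I : ThetaVolumeInput (fieldOfModuli E) K} (hI : ThetaData.IsVolumeInputOf D I) (hF : Module.finrank ℚ (fieldOfModuli E) = 1) :
    (settingPrVolSharp (pilotDataOfK D K) (logvAnalytic_analyticLogv (F := K)) M archPk archSub Ψ act Mmod region n lat
        sig split qData tq t htq0 htq1).SlotStatement ↔
      (settingPrVolSharp (pilotDataOfK D K) (logvAnalytic_analyticLogv (F := K)) M archPk archSub Ψ act Mmod region n lat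
        sig split qData tq t htq0 htq1).Statement :=
  slotStatement_iff_statement_settingPrVolSharp_pilotDataOfK_of_slotConstant D M archPk archSub Ψ act Mmod region n lat sig split qData tq t htq0 htq1 ht0 hT hI fun p hp i v w => by
    haveI : Fact p.Prime := ⟨I.prime_of_mem_supportPrimes hp⟩
    exact DHData.slotConstant_of_finrank_eq_one hF (fun u => I.X.slotValue i u.1) v w

/-! ## §5. The reading-(P) statement READ OUT in Dupuy–Hilado's currency: `SlotStatement ↔ I.Cor312PerImageNonarchOf` -/

/-- **`SlotStatement(sharp K-setting) ↔ I.Cor312PerImageNonarchOf`** for EVERY realising choice of Θ-ideles AND `q`-ideles: the typed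
reading-(P) conclusion of [IUTchIII] Cor. 3.12 (γ's per-datum binder `hstPBad`) IS «Dupuy–Hilado's (1.1) PER IMAGE, nonarchimedean form»
(`−|log(q)| ≤ −|log(Θ)|_(P)` for the genuine input; abc-iut-S7 `ThetaVolumeInput.Cor312PerImageNonarchOf`) — the reading-(P) twin of
abc-iut-s2-p7's `statement_settingPrVolSharp_pilotDataOfK_iff_cor312NonarchOf` (p453952). `q`-side: abc-iut-c312-7 `negLogQ_settingPrVolSharp`,
abc-iut-C-cert-3 `absLogq_eq_ndeg_qPilot_pilotDataOfK`, abc-iut-c312-8 `negAbsLogQ_eq_neg_absLogq_of_isVolumeInputOf`; Θ-side: p462135.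
[cite: Mochizuki2012, IUTchIII Cor. 3.12 p. 174 l. 4–18, proof Step (x) p. 181] [cite: DupuyHilado2025, §1 (1.1), §4.12]
[claim: Mochizuki2012, status: disputed] -/
theorem slotStatement_settingPrVolSharp_pilotDataOfK_iff_cor312PerImageNonarchOf (ht0 : ∀ pp i x, t pp i x ≠ 0)
    (hT : ∀ (pp : Nat.Primes) (i : Fin (pilotDataOfK D K).lstar) (x : (thetaIndex (pilotDataOfK D K)).Fibre (.inr pp)),
      haveI : Fact (pp : ℕ).Prime := ⟨pp.2⟩
      Real.log ‖t pp i x‖ = -((pilotDataOfK D K).thetaPilot i (placeOf (pilotDataOfK D K) pp.1 x)) *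
        logNorm K (placeOf (pilotDataOfK D K) pp.1 x) / localDegree K (placeOf (pilotDataOfK D K) pp.1 x))
    (htq : ∀ (pp : Nat.Primes) (x : (thetaIndex (pilotDataOfK D K)).Fibre (.inr pp)),
      haveI : Fact (pp : ℕ).Prime := ⟨pp.2⟩
      Real.log ‖tq pp x‖ = -((pilotDataOfK D K).qPilot (placeOf (pilotDataOfK D K) pp.1 x)) *
        logNorm K (placeOf (pilotDataOfK D K) pp.1 x) / localDegree K (placeOf (pilotDataOfK D K) pp.1 x))
    {I : ThetaVolumeInput (fieldOfModuli E) K} (hI : ThetaData.IsVolumeInputOf D I) :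
    (settingPrVolSharp (pilotDataOfK D K) (logvAnalytic_analyticLogv (F := K)) M archPk archSub Ψ act Mmod region n lat
        sig split qData tq t htq0 htq1).SlotStatement ↔ I.Cor312PerImageNonarchOf := by
  unfold Cor312.Setting.SlotStatement
  rw [negLogQ_settingPrVolSharp (pilotDataOfK D K) (logvAnalytic_analyticLogv (F := K)) M archPk archSub Ψ act Mmod region n lat sig
      split qData t tq htq0 htq1 htq,
    negLogThetaSlot_settingPrVolSharp_pilotDataOfK_eq_negLogThetaPerImageNonarch_of_isVolumeInputOf D M archPk archSub Ψ act Mmod region n lat sig split qData tq t htq0 htq1 ht0 hT hI,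
    WithTop.coe_le_coe, ThetaVolumeInput.Cor312PerImageNonarchOf, negAbsLogQ_eq_neg_absLogq_of_isVolumeInputOf D hI,
    absLogq_eq_ndeg_qPilot_pilotDataOfK D K]
  exact ⟨fun h => h.2, fun h => ⟨WithTop.coe_ne_top, h⟩⟩

/-- **Hence, per datum: the reading-(P) conclusion implies Dupuy–Hilado's (1.1) in BOTH forms** — `I.Cor312PerImageNonarchOf` and (the (P) form
being the stronger, `vol_(P) ≤ vol_(U)` for the genuine input, abc-iut-S-d1 `negLogThetaPerImageNonarch_le_negLogThetaNonarch`) `I.Cor312NonarchOf`.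
[cite: Mochizuki2012, IUTchIII Cor. 3.12 p. 174] [cite: DupuyHilado2025, §1 (1.1)] [claim: Mochizuki2012, status: disputed] -/
theorem GenuineK.cor312NonarchOf_of_slotStatement (ht0 : ∀ pp i x, t pp i x ≠ 0)
    (hT : ∀ (pp : Nat.Primes) (i : Fin (pilotDataOfK D K).lstar) (x : (thetaIndex (pilotDataOfK D K)).Fibre (.inr pp)),
      haveI : Fact (pp : ℕ).Prime := ⟨pp.2⟩
      Real.log ‖t pp i x‖ = -((pilotDataOfK D K).thetaPilot i (placeOf (pilotDataOfK D K) pp.1 x)) *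
        logNorm K (placeOf (pilotDataOfK D K) pp.1 x) / localDegree K (placeOf (pilotDataOfK D K) pp.1 x))
    (htq : ∀ (pp : Nat.Primes) (x : (thetaIndex (pilotDataOfK D K)).Fibre (.inr pp)),
      haveI : Fact (pp : ℕ).Prime := ⟨pp.2⟩
      Real.log ‖tq pp x‖ = -((pilotDataOfK D K).qPilot (placeOf (pilotDataOfK D K) pp.1 x)) *
        logNorm K (placeOf (pilotDataOfK D K) pp.1 x) / localDegree K (placeOf (pilotDataOfK D K) pp.1 x))
    {I : ThetaVolumeInput (fieldOfModuli E) K} (hI : ThetaData.IsVolumeInputOf D I)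
    (hst : (settingPrVolSharp (pilotDataOfK D K) (logvAnalytic_analyticLogv (F := K)) M archPk archSub Ψ act Mmod region n lat
        sig split qData tq t htq0 htq1).SlotStatement) :
    I.Cor312PerImageNonarchOf ∧ I.Cor312NonarchOf := by
  have hP := (slotStatement_settingPrVolSharp_pilotDataOfK_iff_cor312PerImageNonarchOf D M archPk archSub Ψ act Mmod region n lat sig split qData tq t htq0 htq1 ht0 hT htq hI).mp hst
  exact ⟨hP, DHData.cor312NonarchOf_of_cor312PerImageNonarchOf I hP⟩

/-- **HOW MUCH STRONGER (P) IS, per datum**: the reading-(U) conclusion (`hstBad`'s body; ⟺ `I.Cor312NonarchOf`, abc-iut-s2-p7 p453952) yields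
Dupuy–Hilado's (1.1) PER IMAGE weakened by EXACTLY the (Ind1) slot residue of the pilot data plus the rounding sum:
`−|log(q)| ≤ −|log(Θ)|_(P)^nonarch(I) + (SR(I) + Σ_{p∈T(I)} log p)` (abc-iut-s2-p2 `negLogThetaNonarch_le_perImage_add_slotResidue`). At slot-constant
data the extra term is `0` (§4). [cite: Mochizuki2012, IUTchIII Cor. 3.12 p. 174, proof Step (x) p. 181] [cite: Mochizuki2012, IUTchIV Thm. 1.10 Step (v)
p. 27–28] [cite: DupuyHilado2025, §1 (1.1), §4.7, §4.12] [claim: Mochizuki2012, status: disputed] -/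
theorem GenuineK.cor312PerImageNonarch_add_slotResidue_of_statement (ht0 : ∀ pp i x, t pp i x ≠ 0)
    (hT : ∀ (pp : Nat.Primes) (i : Fin (pilotDataOfK D K).lstar) (x : (thetaIndex (pilotDataOfK D K)).Fibre (.inr pp)),
      haveI : Fact (pp : ℕ).Prime := ⟨pp.2⟩
      Real.log ‖t pp i x‖ = -((pilotDataOfK D K).thetaPilot i (placeOf (pilotDataOfK D K) pp.1 x)) *
        logNorm K (placeOf (pilotDataOfK D K) pp.1 x) / localDegree K (placeOf (pilotDataOfK D K) pp.1 x))
    (htq : ∀ (pp : Nat.Primes) (x : (thetaIndex (pilotDataOfK D K)).Fibre (.inr pp)),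
      haveI : Fact (pp : ℕ).Prime := ⟨pp.2⟩
      Real.log ‖tq pp x‖ = -((pilotDataOfK D K).qPilot (placeOf (pilotDataOfK D K) pp.1 x)) *
        logNorm K (placeOf (pilotDataOfK D K) pp.1 x) / localDegree K (placeOf (pilotDataOfK D K) pp.1 x))
    {I : ThetaVolumeInput (fieldOfModuli E) K} (hI : ThetaData.IsVolumeInputOf D I)
    (hst : (settingPrVolSharp (pilotDataOfK D K) (logvAnalytic_analyticLogv (F := K)) M archPk archSub Ψ act Mmod region n lat
        sig split qData tq t htq0 htq1).Statement) :
    I.negAbsLogQ ≤ I.negLogThetaPerImageNonarch + (I.X.slotResidue I.supportPrimes + ∑ p ∈ I.supportPrimes, Real.log p) := by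
  have hU : I.Cor312NonarchOf := (statement_settingPrVolSharp_pilotDataOfK_iff_cor312NonarchOf D M archPk archSub Ψ act Mmod region n lat sig split qData tq t htq0 htq1 ht0 hT htq hI).mp hst
  unfold ThetaVolumeInput.Cor312NonarchOf at hU
  linarith [I.negLogThetaNonarch_le_perImage_add_slotResidue]

/-! ## §6. At a genuine Θ-volume DATUM, for the CHOSEN realising ideles (the binder shape of the `K`-line certificates) -/

/-- **At a datum `T : Cor22.ThetaVolumeDatumAt P l`, for the CHOSEN realising `q`- and Θ-ideles** (`exists_realising_qIdeles_pilotDataOfK T.D`,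
`exists_realising_thetaIdeles_pilotDataOfK T.D` — EXACTLY the setting term of the γ certificate's binders `hstPBad` / `hNumPOffBad` / `hReadP`,
abc-iut-C-cert-2 p458998, and of the (U) statement lines' `hstBad`, abc-iut-s2-p10 p455513): (a) `SlotStatement ↔ T.I.Cor312PerImageNonarchOf`
— γ's reading-(P) [C312-P] binder reads, per datum, EXACTLY «Dupuy–Hilado (1.1) per image for the datum's genuine input»; (b) `SlotStatement →
Statement` — γ's `hstPBad` body implies the (U) lines' `hstBad` body at every datum. Nothing asserted about either. [cite: Mochizuki2012, IUTchIII
Cor. 3.12 p. 174 l. 16–18, proof Step (x) p. 181] [cite: DupuyHilado2025, §1 (1.1), §4.12] [claim: Mochizuki2012, status: disputed] -/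
theorem slotStatement_settingPrVolSharp_pilotDataOfK_chosen_readout
    {P : Literature.NumberTheory.DiophantineGeometry.GenEll.NFPoint} {l : ℕ} (T : Cor22.ThetaVolumeDatumAt P l) :
    letI := T.instFieldF; letI := T.instNumberFieldF; letI := T.instAlgebraF; letI := T.instFieldK;
    letI := T.instNumberFieldK; letI := T.instAlgebraK; letI := T.instFieldFbar; letI := T.instAlgebraFbar;
    letI := T.instAlgebraKFbar; letI := T.instIsElliptic;
    ∀ (M : Type) [Field M] [NumberField M]
      (archPk : ∀ (j : (thetaIndex (pilotDataOfK T.D T.K)).Label) (vQ : (thetaIndex (pilotDataOfK T.D T.K)).VQ),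
        Set ((logShellsDH (pilotDataOfK T.D T.K) (analyticLogv T.K)).Packet j vQ))
      (archSub : ∀ (j : (thetaIndex (pilotDataOfK T.D T.K)).Label) (v : (thetaIndex (pilotDataOfK T.D T.K)).V),
        Set ((logShellsDH (pilotDataOfK T.D T.K) (analyticLogv T.K)).Packet j ((thetaIndex (pilotDataOfK T.D T.K)).over v)))
      (Ψ : ℤ → ∀ v : (thetaIndex (pilotDataOfK T.D T.K)).V, v ∈ (thetaIndex (pilotDataOfK T.D T.K)).Vbad →
        Set ((logShellsDH (pilotDataOfK T.D T.K) (analyticLogv T.K)).StarPacket v))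
      (act : ℤ → ∀ v : (thetaIndex (pilotDataOfK T.D T.K)).V, v ∈ (thetaIndex (pilotDataOfK T.D T.K)).Vbad →
        (logShellsDH (pilotDataOfK T.D T.K) (analyticLogv T.K)).StarPacket v →
          Module.End ℚ ((logShellsDH (pilotDataOfK T.D T.K) (analyticLogv T.K)).StarPacket v))
      (Mmod : ℤ → ∀ j : (thetaIndex (pilotDataOfK T.D T.K)).LabelStar,
        Set ((logShellsDH (pilotDataOfK T.D T.K) (analyticLogv T.K)).GlobalPacket j.1))
      (region : ℤ → ∀ j : (thetaIndex (pilotDataOfK T.D T.K)).LabelStar, FinDivisor M →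
        ∀ vQ : (thetaIndex (pilotDataOfK T.D T.K)).VQ, Set ((logShellsDH (pilotDataOfK T.D T.K) (analyticLogv T.K)).Packet j.1 vQ))
      (n : ℤ) {HT : Type} {LogLink : HT → HT → Type} {IsFull : ∀ {s t : HT}, LogLink s t → Prop}
      (lat : LGPGaussianLogThetaLattice LogLink IsFull)
      {Frd : Type} {IsoF : Frd → Frd → Type} {Ob : Frd → Type} {realify : Frd → Frd} {Strip : Type}
      {IsoS : Strip → Strip → Type}
      {Mv : ∀ v : (thetaIndex (pilotDataOfK T.D T.K)).V, v ∈ (thetaIndex (pilotDataOfK T.D T.K)).Vbad → Type}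
      [∀ v h, Monoid (Mv v h)]
      (sig : GlobalLGPFrobenioidSignature (thetaIndex (pilotDataOfK T.D T.K)).lstar (thetaIndex (pilotDataOfK T.D T.K)).V
        (· ∈ (thetaIndex (pilotDataOfK T.D T.K)).Vbad) Frd IsoF Ob realify Strip IsoS Mv)
      (split : SplittingMonoids Mv) {ObΔ : Type}
      {N : ∀ v : (thetaIndex (pilotDataOfK T.D T.K)).V, v ∈ (thetaIndex (pilotDataOfK T.D T.K)).Vbad → Type} [∀ v h, Monoid (N v h)]
      (qData : QPilotData ObΔ N),
      ((settingPrVolSharp (pilotDataOfK T.D T.K) (logvAnalytic_analyticLogv (F := T.K)) M archPk archSub Ψ act Mmod region n lat sig split qData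
          (exists_realising_qIdeles_pilotDataOfK T.D).choose
          (exists_realising_thetaIdeles_pilotDataOfK T.D).choose
          (exists_realising_qIdeles_pilotDataOfK T.D).choose_spec.1
          (exists_realising_qIdeles_pilotDataOfK T.D).choose_spec.2.1).SlotStatement ↔ T.I.Cor312PerImageNonarchOf) ∧
      ((settingPrVolSharp (pilotDataOfK T.D T.K) (logvAnalytic_analyticLogv (F := T.K)) M archPk archSub Ψ act Mmod region n lat sig split qData
          (exists_realising_qIdeles_pilotDataOfK T.D).choose
          (exists_realising_thetaIdeles_pilotDataOfK T.D).choose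
          (exists_realising_qIdeles_pilotDataOfK T.D).choose_spec.1
          (exists_realising_qIdeles_pilotDataOfK T.D).choose_spec.2.1).SlotStatement →
        (settingPrVolSharp (pilotDataOfK T.D T.K) (logvAnalytic_analyticLogv (F := T.K)) M archPk archSub Ψ act Mmod region n lat sig split qData
          (exists_realising_qIdeles_pilotDataOfK T.D).choose
          (exists_realising_thetaIdeles_pilotDataOfK T.D).choose
          (exists_realising_qIdeles_pilotDataOfK T.D).choose_spec.1
          (exists_realising_qIdeles_pilotDataOfK T.D).choose_spec.2.1).Statement) := by
  intro M _ _ archPk archSub Ψ act Mmod region n HT LogLink IsFull lat Frd IsoF Ob realify Strip IsoS Mv _ sig split ObΔ N _ qData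
  letI := T.instFieldF; letI := T.instNumberFieldF; letI := T.instAlgebraF; letI := T.instFieldK
  letI := T.instNumberFieldK; letI := T.instAlgebraK; letI := T.instFieldFbar; letI := T.instAlgebraFbar
  letI := T.instAlgebraKFbar; letI := T.instIsElliptic
  exact ⟨slotStatement_settingPrVolSharp_pilotDataOfK_iff_cor312PerImageNonarchOf T.D M archPk archSub Ψ act Mmod region n lat sig split
      qData _ _ _ _ (exists_realising_thetaIdeles_pilotDataOfK T.D).choose_spec.1 (exists_realising_thetaIdeles_pilotDataOfK T.D).choose_spec.2.2
      (exists_realising_qIdeles_pilotDataOfK T.D).choose_spec.2.2 T.isVolumeInputOf,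
    statement_of_slotStatement_settingPrVolSharp_pilotDataOfK T.D M archPk archSub Ψ act Mmod region n lat sig split qData _ _ _ _
      (exists_realising_thetaIdeles_pilotDataOfK T.D).choose_spec.1 (exists_realising_thetaIdeles_pilotDataOfK T.D).choose_spec.2.2⟩

end Summit.ABC.IUTFork.Thm311.Real

end
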